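import Literature.NumberTheory.DiophantineGeometry.AbcWave0

/-!
# Stub `stub_thueOfCellZeroLittleO` of line `Sketch` — crux `DepthCountedABC` (stmt-ABC-14938)

WHAT.  The converse, on the 5-free cell, of the cell-0 little-o certificate `stub_cellZeroLittleO`
(`c = o(rad(abc)²)` on the 5-free cell, a theorem by Roth): IF for every `κ > 0` only boundedly many
5-free abc triples have `c ≥ κ·rad(abc)²`, THEN for every single coefficient class `(a, u, v)` the positive
coprime solutions `(Y, Z)` of the binomial quartic Thue equation `a + u·Y⁴ = v·Z⁴` whose triple
`(a, uY⁴, vZ⁴)` lies in the 5-free cell have bounded `Z` — Thue's finiteness theorem, fibre by fibre,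
on the cell.  Together with `stub_cellZeroLittleO`: on cell 0 "free exponent `2` improved by `o(1)`"
⟺ Thue fibrewise (a THEOREM), while "`rad^(2−δ)`" ⟺ UNIFORM quartic Thue ⟺ crux #4
`TowerFourSubLiouville` (open) — the remaining content of the cell below exponent `2` is exactly
uniformity in Thue–Siegel–Roth.

MECHANISM (elementary).  For the triple `(a, b, c) = (a, uY⁴, vZ⁴)`:
`rad(abc) ≤ rad a · rad b · rad c ≤ a·(uY)·(vZ)` and `Y⁴ ≤ b < c`, `Z⁴ ≤ c`, so
`rad⁴ ≤ (a·u·v)⁴·Y⁴·Z⁴ < (a·u·v)⁴·c²`, i.e. `rad² < (a·u·v)²·c`.  At `κ := (a·u·v)⁻²` the hypothesis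
gives `c₀` with `c < κ·rad² < c` whenever `c ≥ c₀` — so `c < c₀`, and `Z ≤ Z⁴ ≤ vZ⁴ = c < c₀`.

Sources: skeleton `Cruxes/DepthCountedABC/Lines/Sketch.lean` (lead c23), stub `stub_thueOfCellZeroLittleO`.
Ingredients: `Literature.NumberTheory.DiophantineGeometry.rad_def`, Mathlib's radical API
(`UniqueFactorizationMonoid.radical_mul_dvd`, `UniqueFactorizationMonoid.radical_pow`,
`Nat.radical_le_self_iff`).  No unproved facts.  Deliberately NOT here: the forward direction
(`stub_cellZeroLittleO`, landed separately) and anything uniform in `(a, u, v)`.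
-/

-- `Summit.<Summit>.<Problem>` is the mandated summit-side namespace (CONVENTIONS §2); for the
-- single-conjunct summit `ABC` the two coincide, so the duplicate `ABC.ABC` is deliberate.
set_option linter.dupNamespace false

namespace Summit.ABC.ABC.Theorems.DepthCountedABC

open UniqueFactorizationMonoid (radical)
open Literature.NumberTheory.DiophantineGeometry (IsABCTriple rad rad_def)

/-- Radical bookkeeping for a binomial quartic datum: `rad(a · uY⁴ · vZ⁴) ≤ a·u·v·Y·Z` for positive
`a, u, v, Y, Z`. [folklore] -/
theorem thueOfCellZeroLittleO_rad_le {a u v Y Z : ℕ} (ha : 0 < a) (hu : 0 < u) (hv : 0 < v)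
    (hY : 0 < Y) (hZ : 0 < Z) :
    rad a (u * Y ^ 4) (v * Z ^ 4) ≤ a * u * v * Y * Z := by
  have hrb : radical (u * Y ^ 4) ≤ u * Y := by
    have h1 : radical (u * Y ^ 4) ∣ radical u * radical (Y ^ 4) := UniqueFactorizationMonoid.radical_mul_dvd
    rw [UniqueFactorizationMonoid.radical_pow Y (by norm_num : (4 : ℕ) ≠ 0)] at h1
    calc radical (u * Y ^ 4) ≤ radical u * radical Y := Nat.le_of_dvd (by positivity) h1
      _ ≤ u * Y := Nat.mul_le_mul (Nat.radical_le_self_iff.mpr hu.ne')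
          (Nat.radical_le_self_iff.mpr hY.ne')
  have hrc : radical (v * Z ^ 4) ≤ v * Z := by
    have h1 : radical (v * Z ^ 4) ∣ radical v * radical (Z ^ 4) := UniqueFactorizationMonoid.radical_mul_dvd
    rw [UniqueFactorizationMonoid.radical_pow Z (by norm_num : (4 : ℕ) ≠ 0)] at h1
    calc radical (v * Z ^ 4) ≤ radical v * radical Z := Nat.le_of_dvd (by positivity) h1
      _ ≤ v * Z := Nat.mul_le_mul (Nat.radical_le_self_iff.mpr hv.ne')
          (Nat.radical_le_self_iff.mpr hZ.ne')
  have hra : radical a ≤ a := Nat.radical_le_self_iff.mpr ha.ne'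
  have h2 : radical (a * (u * Y ^ 4) * (v * Z ^ 4)) ≤
      radical (a * (u * Y ^ 4)) * radical (v * Z ^ 4) :=
    Nat.le_of_dvd (by positivity) UniqueFactorizationMonoid.radical_mul_dvd
  have h3 : radical (a * (u * Y ^ 4)) ≤ radical a * radical (u * Y ^ 4) :=
    Nat.le_of_dvd (by positivity) UniqueFactorizationMonoid.radical_mul_dvd
  calc rad a (u * Y ^ 4) (v * Z ^ 4) = radical (a * (u * Y ^ 4) * (v * Z ^ 4)) := rad_def _ _ _
    _ ≤ radical a * radical (u * Y ^ 4) * radical (v * Z ^ 4) :=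
        h2.trans (Nat.mul_le_mul_right _ h3)
    _ ≤ a * (u * Y) * (v * Z) := Nat.mul_le_mul (Nat.mul_le_mul hra hrb) hrc
    _ = a * u * v * Y * Z := by ring

/-- **Stub `stub_thueOfCellZeroLittleO` of line `Sketch`, crux `DepthCountedABC` (stmt-ABC-14938):**
the cell-0 little-o statement (`∀ κ > 0 ∃ c₀`, every 5-free abc triple with `c ≥ c₀` has `c < κ·rad²`)
implies, for every coefficient class `(a, u, v)` of positive integers, a bound on `Z` over the positive
solutions of `a + u·Y⁴ = v·Z⁴` with `gcd(uY⁴, vZ⁴) = 1` whose triple `(a, uY⁴, vZ⁴)` is 5-free —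
Thue's finiteness theorem for these binomial quartic equations, fibrewise, on the cell. [folklore] -/
theorem stub_thueOfCellZeroLittleO :
    (∀ κ : ℝ, 0 < κ → ∃ c₀ : ℕ, ∀ a b c : ℕ,
      Literature.NumberTheory.DiophantineGeometry.IsABCTriple a b c →
      ((a * b * c).primeFactors.filter (fun p => 5 ≤ (a * b * c).factorization p)).card = 0 →
      c₀ ≤ c → (c : ℝ) < κ * ((Literature.NumberTheory.DiophantineGeometry.rad a b c : ℕ) : ℝ) ^ 2) →
    ∀ a u v : ℕ, 0 < a → 0 < u → 0 < v → ∃ B : ℕ, ∀ Y Z : ℕ, 0 < Y → 0 < Z →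
      a + u * Y ^ 4 = v * Z ^ 4 → Nat.Coprime (u * Y ^ 4) (v * Z ^ 4) →
      ((a * (u * Y ^ 4) * (v * Z ^ 4)).primeFactors.filter
          (fun p => 5 ≤ (a * (u * Y ^ 4) * (v * Z ^ 4)).factorization p)).card = 0 → Z ≤ B := by
  intro h a u v ha hu hv
  -- the constant of the class `(a, u, v)`
  set A : ℝ := ((a * u * v : ℕ) : ℝ) with hA
  have hA1 : (1 : ℝ) ≤ A := by
    have : 1 ≤ a * u * v := Nat.one_le_iff_ne_zero.mpr (by positivity)
    rw [hA]; exact_mod_cast this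
  have hApos : 0 < A := by linarith
  obtain ⟨c₀, hc₀⟩ := h (A ^ 2)⁻¹ (by positivity)
  refine ⟨c₀, ?_⟩
  intro Y Z hY hZ hsum hcop h0
  -- the abc triple `(a, uY⁴, vZ⁴)`
  set b : ℕ := u * Y ^ 4 with hb
  set c : ℕ := v * Z ^ 4 with hc
  have hbpos : 0 < b := by positivity
  have hab : Nat.Coprime a b := by
    have h1 : Nat.Coprime b (a + b) := by rw [hsum]; exact hcop
    rw [add_comm, Nat.coprime_self_add_right] at h1
    exact h1.symm
  have habc : IsABCTriple a b c := ⟨ha, hbpos, hsum, hab⟩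
  -- `Z ≤ c`; so it suffices that `c < c₀`
  have hZc : Z ≤ c := by
    calc Z ≤ Z ^ 4 := Nat.le_self_pow (by norm_num) Z
      _ ≤ v * Z ^ 4 := Nat.le_mul_of_pos_left _ hv
  by_contra hZB
  have hcc₀ : c₀ ≤ c := by omega
  have hlt := hc₀ a b c habc h0 hcc₀
  -- `rad² < A²·c`
  set R : ℕ := rad a b c with hR
  have hRle : R ≤ a * u * v * Y * Z := thueOfCellZeroLittleO_rad_le ha hu hv hY hZ
  have hY4 : Y ^ 4 < c := by
    have h1 : Y ^ 4 ≤ b := Nat.le_mul_of_pos_left _ hu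
    omega
  have hZ4 : Z ^ 4 ≤ c := Nat.le_mul_of_pos_left _ hv
  have hR4 : R ^ 4 < (a * u * v) ^ 4 * c ^ 2 := by
    have hYZ : Y ^ 4 * Z ^ 4 < c * c :=
      Nat.mul_lt_mul_of_lt_of_le hY4 hZ4 (by positivity)
    calc R ^ 4 ≤ (a * u * v * Y * Z) ^ 4 := Nat.pow_le_pow_left hRle 4
      _ = (a * u * v) ^ 4 * (Y ^ 4 * Z ^ 4) := by ring
      _ < (a * u * v) ^ 4 * (c * c) := Nat.mul_lt_mul_of_pos_left hYZ (by positivity)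
      _ = (a * u * v) ^ 4 * c ^ 2 := by ring
  have hR2 : (R : ℝ) ^ 2 < A ^ 2 * (c : ℝ) := by
    have h1 : ((R : ℝ) ^ 2) ^ 2 < (A ^ 2 * (c : ℝ)) ^ 2 := by
      have h' : ((R ^ 4 : ℕ) : ℝ) < (((a * u * v) ^ 4 * c ^ 2 : ℕ) : ℝ) := by exact_mod_cast hR4
      have e1 : ((R ^ 4 : ℕ) : ℝ) = ((R : ℝ) ^ 2) ^ 2 := by push_cast; ring
      have e2 : (((a * u * v) ^ 4 * c ^ 2 : ℕ) : ℝ) = (A ^ 2 * (c : ℝ)) ^ 2 := by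
        rw [hA]; push_cast; ring
      rw [e1, e2] at h'
      exact h'
    have h2 : (0 : ℝ) ≤ A ^ 2 * (c : ℝ) := by positivity
    exact lt_of_pow_lt_pow_left₀ 2 h2 h1
  -- `c < A⁻²·rad² < c`
  have hcontra : (c : ℝ) < (c : ℝ) := by
    calc (c : ℝ) < (A ^ 2)⁻¹ * (R : ℝ) ^ 2 := hlt
      _ < (A ^ 2)⁻¹ * (A ^ 2 * (c : ℝ)) := mul_lt_mul_of_pos_left hR2 (by positivity)
      _ = (c : ℝ) := by field_simp
  exact lt_irrefl _ hcontra

end Summit.ABC.ABC.Theorems.DepthCountedABC
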